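import Summits.HodgeConjecture.HodgeConjecture.Theses.PadicSemiregularLift
import Literature.AlgebraicGeometry.KTheory.HuInfinitesimalKZero
import HarnessLib

/-!
# Route `PadicSemiregularLift`, item `HuInfinitesimalKZero` (stmt-HodgeConjecture-15973): the bridge to Hu's two named facts

The route declaration `HuInfinitesimalKZero` (route-choice promotion of 2026-08-16) is, verbatim,
the conjunction of the BODIES of the two Literature claims of
`Literature/AlgebraicGeometry/KTheory/HuInfinitesimalKZero.lean`:

* `KTheory.HuKZeroLiftingCriterion` — X. Hu, arXiv:2507.12458, Thm. 1.2 = Prop. 11.1(i) (p. 65) with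
  the level compatibility of Prop. 9.6(i) / Def. 8.3 (`d + 6 ≤ p`): existence of Hodge obstruction
  maps `ob m n : K₀(X_m) → ⊕_{r=1}^{d−1} ℍ^{2r}(p^{r,m}_{r,n}Ω•)` cutting out the image of
  `K₀(X_n) → K₀(X_m)` for `1 ≤ m < n`;
* `KTheory.HuKZeroKernelPresentation` — Cor. 10.5(i) (p. 52) at `i = 0` (`d + 5 ≤ p`) with the exact
  sequence `K₀(X_n, X_m) → K₀(X_n) → K₀(X_m)` and Prop. 9.6(ii): existence of
  `ρ m n : ⊕_{r=1}^{p−1} ℍ^{2r−1}(p^{r,m}_{r,n}Ω•) → K₀(X_n)` onto the kernel of the restriction.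

Both are claim-tagged ("under-review") statements of an unrefereed 138-pp. preprint whose proofs
(Brun's isomorphism, topological cyclic homology, infinitesimal motivic complexes, Gillet–Totaro
Chern classes) are far outside the tree; neither `_holds` discharge exists. This file records,
kernel-checked, exactly how the item sits on them:

* `huInfinitesimalKZero_iff` — `HuInfinitesimalKZero ↔ HuKZeroLiftingCriterion ∧ HuKZeroKernelPresentation`
  (definitional: `Iff.rfl`);
* `huInfinitesimalKZero_of_huFacts` — the CONDITIONAL closing term (the item closes by
  `huInfinitesimalKZero_of_huFacts HuKZeroLiftingCriterion_holds HuKZeroKernelPresentation_holds`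
  the day both discharges land);
* conversely `huInfinitesimalKZero_iff.mp` feeds the consumers typed against the Literature facts
  (`HuLine.formalLiftingFromClassLifting_of_hu`, `…HuReduction`, `…HuLowDimension`) from the route
  hypothesis `(hHu : HuInfinitesimalKZero)` (glue item `FormalLiftingFromClassLiftingOfHu`:
  `(huInfinitesimalKZero_iff.mp hHu).1 / .2`).

Source audit (this seat and prover seat 0, `Cruxes/HuInfinitesimalKZero/AUDIT-prover-0.md`): the
typed clauses match the printed statements (levels `n > m ≥ 1`, ranges `r = 1..d−1` / `r = 1..p−1`,
degrees `2r` / `2r−1`, bounds `d ≤ p−6` / `d ≤ p−5`, Def. 8.2 complexes); the carriers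
(`KTheory.KZero`, `WittScheme.thickening`, `Crystalline.huComplexInt`, `SheafHypercohomology`) are
genuine constructions, so no degenerate proof or refutation is available — the item is exactly as
hard as the two facts.
-/

set_option linter.dupNamespace false

namespace Summit.HodgeConjecture.HodgeConjecture.Theorems

open Literature.AlgebraicGeometry

/-- The route item `HuInfinitesimalKZero` is (definitionally) the conjunction of X. Hu's two named
facts `KTheory.HuKZeroLiftingCriterion` (arXiv:2507.12458, Thm. 1.2 / Prop. 11.1(i)) and
`KTheory.HuKZeroKernelPresentation` (Cor. 10.5(i), `i = 0`): the route file unfolds their bodies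
verbatim. [cite: Hu2025TruncatedWitt, Thm. 1.2 (p. 4), Cor. 10.5(i) (p. 52)] -/
theorem huInfinitesimalKZero_iff :
    Theses.PadicSemiregularLift.HuInfinitesimalKZero ↔
      (KTheory.HuKZeroLiftingCriterion ∧ KTheory.HuKZeroKernelPresentation) :=
  Iff.rfl

/-- **Conditional closing term** for item stmt-HodgeConjecture-15973: Hu's lifting criterion and
kernel presentation (the two claim-tagged, under-review named facts of
`KTheory/HuInfinitesimalKZero`, NOT proved in the tree) give the route item `HuInfinitesimalKZero`. Conditional on both facts; the item closes by
this term applied to their `_holds` discharges once those exist.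
[cite: Hu2025TruncatedWitt, Thm. 1.2 (p. 4), Prop. 11.1(i) (p. 65), Cor. 10.5(i) (p. 52), Prop. 9.6 (p. 47)] -/
theorem huInfinitesimalKZero_of_huFacts (h₁ : KTheory.HuKZeroLiftingCriterion)
    (h₂ : KTheory.HuKZeroKernelPresentation) :
    Theses.PadicSemiregularLift.HuInfinitesimalKZero :=
  huInfinitesimalKZero_iff.mpr ⟨h₁, h₂⟩

end Summit.HodgeConjecture.HodgeConjecture.Theorems
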